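import Summits.QuantumFields.BalabanUV.Beta.NVertexLamCorePeriodised

/-!
# `BalabanUV.Beta.NVertexLamRoadCorePeriodised` — row D1 ∕ (C1), PART 19: **THE ROAD's DISPLAYED STOREY CORE `w · Σ_ā hb ā · (SLam N₁ cf 𝒽 ā)|ff` IS A
# WEIGHTED BRICK CORE, so PART 16 periodises it too: `dper Tc (road core) = −Σ_κ Σ_{r ∈ pbox Tc′} (Σ'_m w · Σ_ā hb ā · cf κ (r + Tc′∘m) ā) · dper Tc (𝒽 κ r)♭` — the
# wrapper's OWN K1∕hlink currency `Σ'_m cf k μ (translate (Ma k) y m) ā` — and (J-Λ-lat)'s per-storey CORE identity follows from the WEIGHT WORD alone**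
# (`dper_slamCore_eq_dper_lamCoreR_of_word`; every road datum `w`, `hb`, `cf`, `N₁` stays DISPLAYED — nothing instantiated by the row)

WHY (located).  Road FP g38's (E4b-shape) `TorusLamJunctionShape.lamJunction_of_dper_eq` (p469378 ✓) DISPLAYS the wrapper's storey kernels `𝒦_{j'}` as
`compLinKer`-sandwiches of the core `fun x y a b => w j' · Σ_{ā ∈ pbox (towerTorus Lc (fine Lc M) j') × Fin 4} hb j' ā · SLam N₁ (cf j') 𝒽 ā.2 ā.1 x y (inl a) (inl b)`
with `𝒽 μ y := symHessFFAt (toSite (ctrOff 4 Lc)) Lc μ y`; the wrapper binds `hb ∕ cf ∕ w` only through (K1) and the ladder `hlink` (`TowerHSideRowsClosing.a1_row`),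
both written in the PERIODISED coefficient `Σ'_m cf k μ (translate (Ma k) y m) ā` over the slot torus `Ma k` (`hMa : towerTorus Lc M k i = Lc · Ma k i`).  PARTs 15–18
put the ROW's side in the same currency (`dper Tc 𝒢ᴿ_k` = `λ′ᴿ_k` periodised over `Ma` × periodised bricks; `λ′ᴿ` obeys the one-brick ladder).  THIS FILE closes
the dictionary on the ROAD's side WITHOUT choosing anything for the road: §1 for ANY finite index set of column bonds `ā ↦ (p₁ ā, p₂ ā)`, weights `hb`, coefficients
`cf`, scalar `w`, blocking `N₁ ≠ 0` and a box brick root `r`, the displayed core IS PART 16's weighted brick core (`slamCore_apply_eq_weightedCore`: an2 PART 8's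
`SLam_apply_eq`, `symHessFFAt_inl_inl`; the slot sums are finitely supported near the field site) with weight `D κ s := w · Σ_ā hb ā · cf κ s (p₁ ā) (p₂ ā)` and
`c := −1`; §2 hence (PART 16 `dper_weightedCore_apply_reps`, under ONE letter: `cf κ · (p₁ ā) (p₂ ā)` summable in the slot) **`dper_slamCore_apply_reps :
dper Tc (road core) γ γ' a a' = (−1) · Σ_κ Σ_{r ∈ pbox Tc′} (Σ'_m w · Σ_ā hb ā · cf κ (translate Tc′ r m) (p₁ ā) (p₂ ā)) · dper Tc (symHessKerAt (toSite r) L κ r)♭ γ γ' a a'`**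
and its diagonal letter `summable_slamCore_diag` (the `hGd` the road's `dper_sandwich_apply` asks); §3 at the record's brick root (`R : Roots Lc`; the road's
`Roots.ctr Lc` has `.r = ctrOff 4 Lc`, `Roots.ctr_r`): **`dper_slamCore_eq_dper_lamCoreR_of_word`** — IF the weight word holds on the slot representatives,
`σ · Σ'_m (w · Σ_ā hb ā · cf κ (translate Tc′ r m) (p₁ ā) (p₂ ā)) = cΛ (j+1) · Σ'_m λ′ᴿ_k (κ, translate Tc′ r m)` for every `κ` and `r ∈ pbox Tc′` (`σ` = the road's
leg scalar of PART 17 `compLinKer_road_eq_scaled`, squared, or `1`), THEN `σ · dper Tc (road core) = dper Tc 𝒢ᴿ_k` entrywise — (J-Λ-lat)'s storey-`k` CORE identity.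
So `hΛN` ⟸ per storey: the weight word (the road's instantiation of `hb ∕ cf ∕ w`; top storey = (K1) for the nested column by PART 16 `lamR_top`, lower
storeys by the two ladders PART 18 `periodised_lamR_succ` ∕ `hlink`) + the road's own `dper_sandwich_apply` on both sides (legs equal by PART 17).

WHAT ([folklore] finite-sum ∕ `tsum` bookkeeping BY NAME; no `def`, no `def … : Prop`, nothing cited, 0 sorry): §1 `summable_cf_mul_brick`, `slamCore_apply_eq_weightedCore`,
`slamCore_eq_weightedCore`; §2 `summable_slamWeight`, **`dper_slamCore_apply_reps`**, `dper_slamCore_apply`, `summable_slamCore_diag`; §3 **`dper_slamCore_eq_dper_lamCoreR_of_word`**.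
WHAT THIS IS NOT: not the weight word itself (the road's instantiation), not (K1) for the nested column, not the `hlink` scalars; not (J-W″)∕(J-X)∕(J-Λ-X); no
row of the END wrapper discharged; 0 estimates; nothing of Bałaban's asserted, valued or discharged; 0∕4 row-D1 binders (hW, hR, D1Tel, D1Rep); ROOT M‴ p325680 ∕
P5c ∕ D6 untouched; NOT (C1), NOT (L2′), NOT D1, NEVER «G-an2-4 closed», NOT BetaPertH, NOT continuum, NOT Clay.

HONEST DEPENDENCY (page 1, mandatory): continuum YM on T⁴ ⇐ BetaPertH ∧ nine spine estimates (0/9 proved); BetaPertH ⇐ (D1) ∧ (D4) ∧ CAP+tail;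
G-an2-4 gates asym, D1 and NE2/3/4.  HONEST FRAMING (cell contract, verbatim): «discharging `BetaPertH` makes Bałaban's UV stability UNCONDITIONAL —
a real constructive-QFT result; it is NOT the continuum limit and NOT the Clay problem.»  ABSOLUTE RULE (cell charter, verbatim): «No internally-minted
statement may enter as a cited fact. Every hypothesis is either kernel-proved in this package or a verbatim quotation of a PUBLISHED theorem with page
reference. The manuscript(s) under audit are NOT citable for their own disputed steps — they are the thing under adjudication; programme-internal
(2001/route/tribunal) claims are never citable.»  Row D1 ∕ (C1) OWNER an2 (b2b-balaban-beta-an2) gen 62, 2026-08-27.  No existing file touched.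
-/

noncomputable section

open scoped BigOperators

namespace Summit.QuantumFields.BalabanUV.Beta.NVertexLamRoadCorePeriodised

open Finset
open Literature.MathematicalPhysics.QuantumFieldTheory
open Literature.MathematicalPhysics.QuantumFieldTheory.Balaban1983to89
open Literature.MathematicalPhysics.QuantumFieldTheory.Balaban1983to89.Beta
open B4TorusKernel.MultiPeriod (translate translate_injective)
open B6Lemma24Torus (pbox)
open AffineAveraging (Site box toSite)
open AveragingHessianKernels (Bond Near)
open ExpKernelCalculus (MKer)
open OneStepResolventKernel (Fib KInv)
open InterLevelTransport (SLam)
open BalabanStepJets (lamCoeffOf)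
open Summit.QuantumFields.BalabanUV.Beta.AxialDressingRooted (one_le_of_neZero)
open Summit.QuantumFields.BalabanUV.Beta.SymAveragingHessianCounts (symLinKerAt symHessKerAt symHessFFAt symHessFFAt_inl_inl symHessKerAt_eq_zero_left
  symHessKerAt_add)
open Summit.QuantumFields.BalabanUV.Beta.CompositeVertexKernelRec (compLinKer)
open Summit.QuantumFields.BalabanUV.Beta.CompositeOneShotJetData (Roots Pins AN)
open Summit.QuantumFields.BalabanUV.Beta.SLamFiniteSourceContraction (SLam_apply_eq)
open Summit.QuantumFields.BalabanUV.Beta.FP.KernelPeriodisationFibLoc (dper dper_apply)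
open Summit.QuantumFields.BalabanUV.Beta.NVertexLamCorePeriodised (slot_mem_nearBox_of_near summable_weightedCore_diag dper_weightedCore_apply
  dper_weightedCore_apply_reps dper_lamCoreR_apply_reps)

variable {d : ℕ}

/-! ## §1 The road's displayed storey core is a weighted brick core -/

section SlamCore

variable {L N₁ : ℕ} [NeZero N₁] {r : Fin (d + 1) → ℕ} (hr : r ∈ box (d + 1) L) (hL : 0 < L)
  {ι : Type*} [Fintype ι] (cf : Fin (d + 1) → Site (d + 1) → Fin (d + 1) → Site (d + 1) → ℝ) (w : ℝ) (hb : ι → ℝ)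
  (p₁ : ι → Fin (d + 1)) (p₂ : ι → Site (d + 1))
include hr hL

/-- [folklore] against a fixed field bond the (0.4)-sym constraint-Hessian brick is finitely supported in its slot (near-box of the field site), so ANY coefficient
times the brick is summable in the slot. -/
theorem summable_cf_mul_brick (c : Site (d + 1) → ℝ) (ν : Fin (d + 1)) (x x' : Site (d + 1)) (a a' : Fin (d + 1)) :
    Summable fun s : Site (d + 1) => c s * symHessKerAt (toSite r) L ν s (a, x) (a', x') :=
  summable_of_ne_finset_zero (s := Fintype.piFinset (fun i => Finset.Icc ((x i - ((2 * L - 1 : ℕ) : ℤ)) / (L : ℤ)) (x i / (L : ℤ))))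
    fun s hs => by rw [symHessKerAt_eq_zero_left hr (f := (a, x)) (fun h => hs (slot_mem_nearBox_of_near hL h)) (a', x'), mul_zero]

/-- [folklore] **`slamCore_apply_eq_weightedCore` — THE ROAD's STOREY CORE, ENTRYWISE, IS A WEIGHTED BRICK CORE**:
`w · Σ_ā hb ā · SLam N₁ cf 𝒽 (p₁ ā) (p₂ ā) x x' (inl a) (inl a') = (−1) · Σ_ν Σ'_s (w · Σ_ā hb ā · cf ν s (p₁ ā) (p₂ ā)) · symHessKerAt (toSite r) L ν s (a,x) (a',x')`,
`𝒽 μ y := symHessFFAt (toSite r) L μ y` (an2 PART 8 `SLam_apply_eq`, `symHessFFAt_inl_inl`; finite `ā`-sum exchanged with the finitely supported slot sum). -/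
theorem slamCore_apply_eq_weightedCore (x x' : Site (d + 1)) (a a' : Fin (d + 1)) :
    w * ∑ i : ι, hb i * SLam N₁ cf (fun μ y => symHessFFAt (toSite r) L μ y) (p₁ i) (p₂ i) x x' (Sum.inl a) (Sum.inl a')
      = (-1) * ∑ ν : Fin (d + 1), ∑' s : Site (d + 1),
          (w * ∑ i : ι, hb i * cf ν s (p₁ i) (p₂ i)) * symHessKerAt (toSite r) L ν s (a, x) (a', x') := by
  have hs : ∀ (i : ι) (ν : Fin (d + 1)), Summable fun s : Site (d + 1) =>
      hb i * (cf ν s (p₁ i) (p₂ i) * symHessKerAt (toSite r) L ν s (a, x) (a', x')) := fun i ν =>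
    ((summable_cf_mul_brick hr hL (fun s => cf ν s (p₁ i) (p₂ i)) ν x x' a a').mul_left (hb i))
  -- each column bond: the stencil entrywise
  have h1 : ∀ i : ι, hb i * SLam N₁ cf (fun μ y => symHessFFAt (toSite r) L μ y) (p₁ i) (p₂ i) x x' (Sum.inl a) (Sum.inl a')
      = -(∑ ν : Fin (d + 1), ∑' s : Site (d + 1), hb i * (cf ν s (p₁ i) (p₂ i) * symHessKerAt (toSite r) L ν s (a, x) (a', x'))) := fun i => by
    rw [SLam_apply_eq]
    simp only [symHessFFAt_inl_inl]
    rw [mul_neg, Finset.mul_sum]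
    congr 1
    exact Finset.sum_congr rfl fun ν _ => tsum_mul_left.symm
  simp_rw [h1]
  rw [Finset.sum_neg_distrib, mul_neg, neg_one_mul]
  congr 1
  rw [Finset.sum_comm, Finset.mul_sum]
  refine Finset.sum_congr rfl fun ν _ => ?_
  rw [← Summable.tsum_finsetSum fun i _ => hs i ν, ← tsum_mul_left]
  refine tsum_congr fun s => ?_
  rw [mul_assoc, Finset.sum_mul, Finset.mul_sum, Finset.mul_sum]
  exact Finset.sum_congr rfl fun i _ => by ring

/-- [folklore] the same as an equality of lattice kernels on the `ff` fibre (`MKer (d+1) (Fin (d+1))`). -/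
theorem slamCore_eq_weightedCore :
    (fun x x' (b b' : Fin (d + 1)) => w * ∑ i : ι, hb i * SLam N₁ cf (fun μ y => symHessFFAt (toSite r) L μ y) (p₁ i) (p₂ i) x x' (Sum.inl b) (Sum.inl b'))
      = fun x x' (b b' : Fin (d + 1)) => (-1) * ∑ ν : Fin (d + 1), ∑' s : Site (d + 1),
          (w * ∑ i : ι, hb i * cf ν s (p₁ i) (p₂ i)) * (fun _ : ℕ => symHessKerAt (toSite r) L) 0 ν s (b, x) (b', x') := by
  funext x x' b b'
  exact slamCore_apply_eq_weightedCore hr hL cf w hb p₁ p₂ x x' b b'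

end SlamCore

/-! ## §2 Hence the road's core periodises like the row's: periodised coefficient × periodised brick over the slot torus -/

section Periodise

variable {L N₁ : ℕ} [NeZero N₁] {r : Fin (d + 1) → ℕ} (hr : r ∈ box (d + 1) L) (hL : 0 < L)
  {ι : Type*} [Fintype ι] (cf : Fin (d + 1) → Site (d + 1) → Fin (d + 1) → Site (d + 1) → ℝ) (w : ℝ) (hb : ι → ℝ)
  (p₁ : ι → Fin (d + 1)) (p₂ : ι → Site (d + 1)) (Tc Tc' : Fin (d + 1) → ℕ)
  (hcf : ∀ (ν : Fin (d + 1)) (i : ι), Summable fun s : Site (d + 1) => cf ν s (p₁ i) (p₂ i))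
include hcf

omit [NeZero N₁] in
/-- [folklore] the road's weight `s ↦ w · Σ_ā hb ā · cf κ s (p₁ ā) (p₂ ā)` is summable in the slot (finite sum of the letter `hcf`). -/
theorem summable_slamWeight (κ : Fin (d + 1)) : Summable fun s : Site (d + 1) => w * ∑ i : ι, hb i * cf κ s (p₁ i) (p₂ i) :=
  (summable_sum fun i _ => (hcf κ i).mul_left (hb i)).mul_left w

include hr hL

/-- [folklore] **`dper_slamCore_apply_reps` — THE ROAD's STOREY CORE, PERIODISED: PERIODISED COEFFICIENT × PERIODISED BRICK OVER THE SLOT TORUS**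
(PART 16 `dper_weightedCore_apply_reps` at `slamCore_eq_weightedCore`; tori `Tc i = L · Tc′ i`):
`dper Tc (road core) γ γ' a a' = (−1) · Σ_κ Σ_{r ∈ pbox Tc′} (Σ'_m w · Σ_ā hb ā · cf κ (translate Tc′ r m) (p₁ ā) (p₂ ā)) · dper Tc (symHessKerAt (toSite r) L κ r)♭ γ γ' a a'`
— the inner `Σ'_m cf κ (translate Tc′ r m) …` is the wrapper's K1∕hlink coefficient. -/
theorem dper_slamCore_apply_reps [∀ i, NeZero (Tc' i)] (hT : ∀ i, Tc i = L * Tc' i) (γ γ' : Site (d + 1)) (a a' : Fin (d + 1)) :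
    dper Tc (fun x x' (b b' : Fin (d + 1)) => w * ∑ i : ι, hb i * SLam N₁ cf (fun μ y => symHessFFAt (toSite r) L μ y) (p₁ i) (p₂ i) x x'
        (Sum.inl b) (Sum.inl b')) γ γ' a a'
      = (-1) * ∑ κ : Fin (d + 1), ∑ ρ : ↥(pbox Tc'),
          (∑' m : Site (d + 1), (w * ∑ i : ι, hb i * cf κ (translate Tc' (ρ : Site (d + 1)) m) (p₁ i) (p₂ i)))
            * dper Tc (fun x x' (b b' : Fin (d + 1)) => symHessKerAt (toSite r) L κ (ρ : Site (d + 1)) (b, x) (b', x')) γ γ' a a' := by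
  rw [slamCore_eq_weightedCore hr hL cf w hb p₁ p₂]
  exact dper_weightedCore_apply_reps (𝓋 := fun _ : ℕ => symHessKerAt (toSite r) L) Tc Tc' (fun _ _ _ _ g' h => symHessKerAt_eq_zero_left hr h g')
    (fun _ μ' y' t g g' => symHessKerAt_add (toSite r) L μ' y' t g g') hL hT (-1) (summable_slamWeight cf w hb p₁ p₂ hcf) 0 γ γ' a a'

/-- [folklore] the same with the slot sum over the lattice (PART 16 `dper_weightedCore_apply`; `1 ≤ Tc′ i`). -/
theorem dper_slamCore_apply (hT : ∀ i, Tc i = L * Tc' i) (hTc' : ∀ i, 1 ≤ Tc' i) (γ γ' : Site (d + 1)) (a a' : Fin (d + 1)) :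
    dper Tc (fun x x' (b b' : Fin (d + 1)) => w * ∑ i : ι, hb i * SLam N₁ cf (fun μ y => symHessFFAt (toSite r) L μ y) (p₁ i) (p₂ i) x x'
        (Sum.inl b) (Sum.inl b')) γ γ' a a'
      = (-1) * ∑ κ : Fin (d + 1), ∑' s : Site (d + 1),
          (∑' m : Site (d + 1), (w * ∑ i : ι, hb i * cf κ (translate Tc' s m) (p₁ i) (p₂ i))) * symHessKerAt (toSite r) L κ s (a, γ) (a', γ') := by
  rw [slamCore_eq_weightedCore hr hL cf w hb p₁ p₂]
  exact dper_weightedCore_apply (𝓋 := fun _ : ℕ => symHessKerAt (toSite r) L) Tc Tc' (fun _ _ _ _ g' h => symHessKerAt_eq_zero_left hr h g')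
    (fun _ μ' y' t g g' => symHessKerAt_add (toSite r) L μ' y' t g g') hL hT hTc' (-1) (summable_slamWeight cf w hb p₁ p₂ hcf) 0 γ γ' a a'

/-- [folklore] **`summable_slamCore_diag` — THE ROAD's CORE's DIAGONAL LETTER** (the `hGd` its `dper_sandwich_apply` asks; PART 16 `summable_weightedCore_diag`). -/
theorem summable_slamCore_diag (hT : ∀ i, Tc i = L * Tc' i) (hTc' : ∀ i, 1 ≤ Tc' i) (γ γ' : Site (d + 1)) (a a' : Fin (d + 1)) :
    Summable fun m : Site (d + 1) =>
      (fun x x' (b b' : Fin (d + 1)) => w * ∑ i : ι, hb i * SLam N₁ cf (fun μ y => symHessFFAt (toSite r) L μ y) (p₁ i) (p₂ i) x x'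
        (Sum.inl b) (Sum.inl b')) (translate Tc γ m) (translate Tc γ' m) a a' := by
  rw [slamCore_eq_weightedCore hr hL cf w hb p₁ p₂]
  exact summable_weightedCore_diag (𝓋 := fun _ : ℕ => symHessKerAt (toSite r) L) Tc Tc' (fun _ _ _ _ g' h => symHessKerAt_eq_zero_left hr h g')
    (fun _ μ' y' t g g' => symHessKerAt_add (toSite r) L μ' y' t g g') hL hT hTc' (-1) (summable_slamWeight cf w hb p₁ p₂ hcf) 0 γ γ' a a'

end Periodise

/-! ## §3 At the record's brick root: the per-storey CORE identity of (J-Λ-lat) from the weight word alone -/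

section Word

variable {Lc : ℕ} [NeZero Lc] (R : Roots Lc) (P : Pins) (j : ℕ) {N₁ : ℕ} [NeZero N₁]
  {ι : Type*} [Fintype ι] (cf : Fin (3 + 1) → Site (3 + 1) → Fin (3 + 1) → Site (3 + 1) → ℝ) (w : ℝ) (hb : ι → ℝ)
  (p₁ : ι → Fin (3 + 1)) (p₂ : ι → Site (3 + 1)) (Tc Tc' : Fin (3 + 1) → ℕ) [∀ i, NeZero (Tc' i)]
  (hcf : ∀ (ν : Fin (3 + 1)) (i : ι), Summable fun s : Site (3 + 1) => cf ν s (p₁ i) (p₂ i))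
include hcf

/-- [folklore] **`dper_slamCore_eq_dper_lamCoreR_of_word` — (J-Λ-lat)'s STOREY-`k` CORE IDENTITY FROM THE WEIGHT WORD**: at the record's brick root
`toSite R.r` (the road's `Roots.ctr Lc`: `.r = ctrOff 4 Lc`), on tori `Tc i = Lc · Tc′ i`, IF for every brick direction `κ` and slot representative `ρ ∈ pbox Tc′`
`σ · Σ'_m (w · Σ_ā hb ā · cf κ (translate Tc′ ρ m) (p₁ ā) (p₂ ā)) = cΛ (j+1) · Σ'_m λ′ᴿ_k (κ, translate Tc′ ρ m)` (the weight word; `σ` any scalar — the road's leg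
scalar squared, or `1`), THEN `σ · dper Tc (w · Σ_ā hb ā · (SLam N₁ cf 𝒽 ā)|ff) γ γ' a a' = dper Tc 𝒢ᴿ_k γ γ' a a'` for all entries (§2 + PART 16 `dper_lamCoreR_apply_reps`). -/
theorem dper_slamCore_eq_dper_lamCoreR_of_word (hT : ∀ i, Tc i = Lc * Tc' i) (σ : ℝ) (k : ℕ) (μ : Fin (3 + 1)) (y : Site (3 + 1))
    (hword : ∀ (κ : Fin (3 + 1)) (ρ : ↥(pbox Tc')),
      σ * ∑' m : Site (3 + 1), (w * ∑ i : ι, hb i * cf κ (translate Tc' (ρ : Site (3 + 1)) m) (p₁ i) (p₂ i))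
        = P.cΛ (j + 1) * ∑' m : Site (3 + 1), ∑ ν : Fin (3 + 1), ∑' w' : Site (3 + 1),
            (∑ κ' : Fin (3 + 1), ∑' u : Site (3 + 1),
                AN R j u (((Lc ^ (j + 1) : ℕ) : ℤ) • y) (Sum.inl κ') (Sum.inr μ) * lamCoeffOf (KInv (N := Lc ^ (j + 1)) (d := 3)) (Lc ^ (j + 1)) ν w' κ' u)
              * compLinKer (fun _ => symLinKerAt (toSite R.r) Lc) Lc (j - k) (κ, translate Tc' (ρ : Site (3 + 1)) m) (ν, w'))
    (γ γ' : Site (3 + 1)) (a a' : Fin (3 + 1)) :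
    σ * dper Tc (fun x x' (b b' : Fin (3 + 1)) => w * ∑ i : ι, hb i * SLam N₁ cf (fun μ' y' => symHessFFAt (toSite R.r) Lc μ' y') (p₁ i) (p₂ i) x x'
        (Sum.inl b) (Sum.inl b')) γ γ' a a'
      = dper Tc (fun x x' (b b' : Fin (3 + 1)) => -(P.cΛ (j + 1)) * ∑ κ : Fin (3 + 1), ∑' s : Site (3 + 1),
          (∑ ν : Fin (3 + 1), ∑' w' : Site (3 + 1),
              (∑ κ' : Fin (3 + 1), ∑' u : Site (3 + 1),
                  AN R j u (((Lc ^ (j + 1) : ℕ) : ℤ) • y) (Sum.inl κ') (Sum.inr μ) * lamCoeffOf (KInv (N := Lc ^ (j + 1)) (d := 3)) (Lc ^ (j + 1)) ν w' κ' u)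
                * compLinKer (fun _ => symLinKerAt (toSite R.r) Lc) Lc (j - k) (κ, s) (ν, w'))
            * symHessKerAt (toSite R.r) Lc κ s (b, x) (b', x')) γ γ' a a' := by
  have hL : 0 < Lc := Nat.pos_of_ne_zero (NeZero.ne Lc)
  rw [dper_slamCore_apply_reps R.hr hL cf w hb p₁ p₂ Tc Tc' hcf hT γ γ' a a', dper_lamCoreR_apply_reps R P j Tc Tc' hT k μ y γ γ' a a',
    ← mul_assoc, Finset.mul_sum, Finset.mul_sum]
  refine Finset.sum_congr rfl fun κ _ => ?_
  rw [Finset.mul_sum, Finset.mul_sum]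
  refine Finset.sum_congr rfl fun ρ _ => ?_
  linear_combination (-(dper Tc (fun x x' (b b' : Fin (3 + 1)) => symHessKerAt (toSite R.r) Lc κ (ρ : Site (3 + 1)) (b, x) (b', x')) γ γ' a a')) * hword κ ρ

end Word

end Summit.QuantumFields.BalabanUV.Beta.NVertexLamRoadCorePeriodised

end
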